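import Literature.NumberTheory.EllipticCurves.TianYuanZhang2017.CMPointSevenBlockDisplays
import Literature.NumberTheory.EllipticCurves.TwoDescentGaloisNormProofs
import HarnessLib

/-!
# THE `2`-DESCENT CLASS OF THE GENUS PERIOD OF A SEVEN-BLOCK IS THE CLASS OF A NORM OF A CM VALUE OF THE LEVEL-32 MODULAR UNIT `x − 2i`
# — the first statement of the U-road in the kernel (crux stmt-BirchSwinnertonDyer-20509 `RamifiedOffTYZOfFacts`, line `offtyz-v7`, LEAD g26, cycle 27, part 6)

HONEST FRAMING (cell `bsd-print-cf2`, route `PrintCf2`; `--supports stmt-BirchSwinnertonDyer-20509`; theorems only, `def`-free, no `sorry`).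
BSD is not proved by any of this; no class is closed by this file; item 23431 (C⁺) and crux 20509 stay OPEN.

After parts 1–4 of this cycle (p787913, p788254, p788929, p789339) the open content of C⁺ on the sector R2 is ONE law about the genus period:
«depth_{A(ℍ′)/tors} Z(lq) = [X(h) ∈ 2ℚ^{×2}]».  The U-road (LEAD g19 §4; bricks g24: `Literature/…/TwoDescentGaloisNormProofs.lean`,
`…/TwoDescentCyclicTraceProofs.lean`) proposes to decide the depth of `Z(lq)` through its `2`-descent (Kummer) classes, which for a Galois TRACE are
NORMS.  The missing input was the display of `Z(n)` for `n ≡ 7 (mod 8)` AS A TRACE — typed this cycle as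
`Literature/…/TianYuanZhang2017/CMPointSevenBlockDisplays.lean` ((S1) `ι(Z(d)) = Σ_{t∈Φ} z^t`, `#Φ = g(d)`; (S2) no `z^t` a cusp; (S3) automorphisms
trivial on `ι(L_d(i))` permute the `z^t`; named fact `tyz_sevenBlockCMData`).  THIS FILE proves, from that display alone:

* §1 `A` over an extension `M`: coefficients fixed by `Aut_ℚ(M)`, split `2`-torsion `(2i′, 0, −2i′)`, the action on coordinates, and «not a cusp ⟹
  abscissa `∉ {0, ±2i′}`» (`Y² = X(X² + 4)`).
* §2 ★★★ `twoDescentComponent_genusPeriod_eq_prod_two_im` / `_zero` — **`κ_M(ι Z(d)) = [∏_{t∈Φ} (x(z^t) − 2i)]`** (resp. `[∏ x(z^t)]` at `τ(1)`):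
  the `2`-descent component of the genus period, read in `M`, is the class of the Φ-product of the CM values of `x − 2i` (resp. `x`) — Silverman X.1.4
  (`δ` is a homomorphism, tree `twoDescentComponent_sum_apply`) on (S1), (S2).
* §3 ★★ `norm_fixed_of_trivialOnL` — by (S3) the Φ-product is FIXED by every automorphism trivial on `ι(L_d(i))` (it is the norm
  `N_{H_d(i)/L_d(i)}(x(z_d) − 2i)` of the source).
* §4 ★★★ `exists_norm_in_H_twoDescentComponent_genusPeriod_eq` — hence (Galois correspondence for `M/ℚ`, Mathlib `IsGalois.fixedField_fixingSubgroup`)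
  the Φ-product DESCENDS: **there is `N₀ ∈ ℍ′_n` with `ι(N₀) = ∏_{t∈Φ}(t x₀ − 2i)` and `κ_M(ι Z(d)) = [ι N₀]`.**
* §5 ★★★ `exists_normClass_genusPeriod_of_facts` / `…_R2` — BY NAME from `tyz_sevenBlockCMData`: for every square-free `n ≡ 5, 6, 7 (mod 8)` and every
  seven-block `d` (in particular `d = n = lq` on R2) a display package with `M`, the CM point `z = (x₀, y₀)`, `Φ` (`#Φ = g(d)`) and such an `N₀`.

WHAT THIS DOES AND DOES NOT GIVE.  The identity is in `M^×/M^{×2}` (`M ⊇ H_d(i)·ℍ′_n`); the class of `Z(d)` over `ℍ′_n` itself (`κ_{ℍ′}(Z(d)) = [x(Z) − 2i]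
∈ ℍ′^×/ℍ′^{×2}`) equals `[N₀]` UP TO the kernel of `ℍ′^×/□ → M^×/□` (classes `a` with `√a ∈ M`) — removing that ambiguity is the DESCENT step of the
U-road (g24's involution / cyclic-`2`-power / odd-degree bricks: the square witness is Galois-fixed), which needs the trace written as iterated chords;
not done here.  Granted it, «`Z(lq) ∉ 2A(ℍ′) + tors`» (law GP0-R2) becomes «`N₀ ∉ ⟨torsion classes⟩·ℍ′^{×2}`», and the law is a statement about
the square class of ONE elliptic-unit-type number `N_{H_n(i)/L_n(i)}(x(z_n) − 2i) ∈ L_n(i)` — inputs (U1)–(U3) of the line (η-quotient form of `x − 2i`,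
Shimura reciprocity, a genus Kronecker-limit evaluation).  No print decides it.

References: [cite: TianYuanZhang2017, §3.1 (p0010 L38, L85–L92, L111; p0011 L1–L8, L53–L66), §3.2 (p0012 L8–L9), Lemma 3.16 (p0017 L98–L101), proof of Lemma 3.21 (p0020 L50–L63)];
[cite: SilvermanAEC2009, Prop. X.1.4, Thm. X.1.1]; [cite: Lang2002, VI §1 Thm. 1.2, Cor. 1.4]; [cite: NeukirchSchmidtWingberg2008, §1.5 (cores = norm)]; tree: g24
`TwoDescentGaloisNormProofs` (`nonsingular_apply_of_fixed`, `twoDescentComponent_sum_apply`), `TwoDescent` (`twoDescentComponent`, `sqClass`), this cycle's display.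
-/

noncomputable section

open scoped Classical

open WeierstrassCurve WeierstrassCurve.Affine WeierstrassCurve.Affine.Point
  Literature.NumberTheory.EllipticCurves
  Literature.NumberTheory.EllipticCurves.TianYuanZhang2017

set_option autoImplicit false

namespace Summit.BirchSwinnertonDyer.PrintCf2.GenusPeriodNorm

open Literature.NumberTheory.EllipticCurves.TianYuanZhang2017.GenusPointData

/-! ## §1 `A` over an extension `M`: coefficients fixed, split `2`-torsion, the action on coordinates, «not a cusp ⟹ x ∉ {0, ±2i}» -/

section OverM

variable {M : Type} [Field M] [NumberField M]

/-- The coefficients of `A/M` (`a₄ = 4`, others `0`) are fixed by every `g ∈ Aut_ℚ(M)`. [cite: TianYuanZhang2017, §3.1 (p0010 L11)] -/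
theorem coeff_fixed_over (g : M ≃ₐ[ℚ] M) :
    (g : M →+* M) (curveA.baseChange M).toAffine.a₁ = (curveA.baseChange M).toAffine.a₁ ∧
    (g : M →+* M) (curveA.baseChange M).toAffine.a₂ = (curveA.baseChange M).toAffine.a₂ ∧
    (g : M →+* M) (curveA.baseChange M).toAffine.a₃ = (curveA.baseChange M).toAffine.a₃ ∧
    (g : M →+* M) (curveA.baseChange M).toAffine.a₄ = (curveA.baseChange M).toAffine.a₄ ∧
    (g : M →+* M) (curveA.baseChange M).toAffine.a₆ = (curveA.baseChange M).toAffine.a₆ := by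
  refine ⟨?_, ?_, ?_, ?_, ?_⟩ <;> simp [curveA, WeierstrassCurve.baseChange, map_ofNat]

/-- `A/M` has the rational `2`-torsion abscissae `2i′, 0, −2i′` for any `i′ ∈ M` with `i′² = −1`. [cite: SilvermanAEC2009, Prop. X.1.4]
[cite: TianYuanZhang2017, Lemma 3.16 (p0017 L98–L101)] -/
theorem splitTwoTorsion_over {im : M} (him : im ^ 2 = -1) :
    (curveA.baseChange M).toAffine.SplitTwoTorsion (2 * im) 0 (-(2 * im)) := by
  have hb₂ : (curveA.baseChange M).toAffine.b₂ = 0 := by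
    simp [WeierstrassCurve.b₂, curveA, WeierstrassCurve.baseChange]
  have hb₄ : (curveA.baseChange M).toAffine.b₄ = 8 := by
    simp [WeierstrassCurve.b₄, curveA, WeierstrassCurve.baseChange]; norm_num
  have hb₆ : (curveA.baseChange M).toAffine.b₆ = 0 := by
    simp [WeierstrassCurve.b₆, curveA, WeierstrassCurve.baseChange]
  refine ⟨?_, ?_, ?_⟩
  · rw [hb₂]; ring
  · rw [hb₄]; linear_combination (8 : M) * him
  · rw [hb₆]; ring

/-- `(X, Y)^g = (gX, gY)` on `A(M)`. [cite: TianYuanZhang2017, §3.1 (p0011 L53–L58)] -/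
theorem galPtOver_some (g : M ≃ₐ[ℚ] M) {x y : M} (h : (curveA.baseChange M).toAffine.Nonsingular x y) :
    galPtOver M g (.some x y h) =
      .some (g x) (g y) (nonsingular_apply_of_fixed (W := (curveA.baseChange M).toAffine) (g : M →+* M)
        (coeff_fixed_over g).1 (coeff_fixed_over g).2.1 (coeff_fixed_over g).2.2.1 (coeff_fixed_over g).2.2.2.1 (coeff_fixed_over g).2.2.2.2 h) := by
  rw [galPtOver, Point.map_some]
  congr 1

/-- A point of `A(M)` with `Y = 0` is killed by `2`. [folklore] -/
theorem two_smul_eq_zero_of_Y_eq_zero {x y : M} (h : (curveA.baseChange M).toAffine.Nonsingular x y) (hy : y = 0) :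
    (2 : ℕ) • (Point.some x y h : APoint M) = 0 := by
  rw [two_nsmul]
  exact WeierstrassCurve.Affine.Point.add_self_of_Y_eq (by
    subst hy; simp [WeierstrassCurve.Affine.negY, curveA, WeierstrassCurve.baseChange])

/-- **Not a cusp ⟹ the abscissa avoids `0, ±2i′`**: if `(X, Y) ∈ A(M)` is not killed by `2` then `X ≠ 0` and `X ≠ ±2i′` (`i′² = −1`), since
`Y² = X(X² + 4)`. [cite: TianYuanZhang2017, §3.2 (p0012 L8–L9: cusps = A[(1+i)³]), Lemma 3.16] -/
theorem X_ne_of_two_smul_ne_zero {im : M} (him : im ^ 2 = -1) {x y : M} (h : (curveA.baseChange M).toAffine.Nonsingular x y)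
    (h2 : (2 : ℕ) • (Point.some x y h : APoint M) ≠ 0) : x ≠ 2 * im ∧ x ≠ 0 ∧ x ≠ -(2 * im) := by
  have heq : y ^ 2 = x ^ 3 + 4 * x := (curveA_nonsingular_iff x y).mp h
  have hy : y ≠ 0 := fun hy => h2 (two_smul_eq_zero_of_Y_eq_zero h hy)
  refine ⟨fun hx => hy ?_, fun hx => hy ?_, fun hx => hy ?_⟩
  · have : y ^ 2 = 0 := by rw [heq, hx]; linear_combination (8 * im) * him
    exact pow_eq_zero_iff two_ne_zero |>.mp this
  · have : y ^ 2 = 0 := by rw [heq, hx]; ring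
    exact pow_eq_zero_iff two_ne_zero |>.mp this
  · have : y ^ 2 = 0 := by rw [heq, hx]; linear_combination (-(8 * im)) * him
    exact pow_eq_zero_iff two_ne_zero |>.mp this

end OverM

/-! ## §2 The `2`-descent class of the genus period of a seven-block IS the class of the Φ-norm of `x(z) − e` (read in `M`) -/

section NormClass

variable {n : ℕ} {M : Type} [Field M] [NumberField M]

/-- ★★★ **`κ_M(Z(d)) = [∏_{t∈Φ} (x(z^t) − e₁)]` for the abscissa `e₁ = 2i` (`T⁺ = (2i, 0)`)**, for the data of the seven-block display (S1)–(S2):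
`ι(Z(d)) = Σ_{t∈Φ} z^t` with `z = (x₀, y₀)` and no `z^t` a cusp.  (The `2`-descent component at `T⁺` is a homomorphism — Silverman X.1.4 — and each
`z^t = (t x₀, t y₀)` has `t x₀ ≠ 2i`.) [cite: TianYuanZhang2017, §3.1 (p0011 L53–L56)] [cite: SilvermanAEC2009, Prop. X.1.4] -/
theorem twoDescentComponent_genusPeriod_eq_prod_two_im (D : GenusPointData n) {d : ℕ} (ι : D.H →ₐ[ℚ] M)
    {x₀ y₀ : M} (h₀ : (curveA.baseChange M).toAffine.Nonsingular x₀ y₀) (Φ : Finset (M ≃ₐ[ℚ] M))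
    (hS1 : Point.map (W' := curveA) ι (D.Z d) = ∑ t ∈ Φ, galPtOver M t (.some x₀ y₀ h₀))
    (hS2 : ∀ t ∈ Φ, ¬ ((2 : ℕ) • galPtOver M t (.some x₀ y₀ h₀) = 0 ∨ (2 : ℕ) • galPtOver M t (.some x₀ y₀ h₀) = tauOne)) :
    Point.twoDescentComponent (curveA.baseChange M).toAffine (2 * ι D.im) 0 (-(2 * ι D.im)) (Point.map (W' := curveA) ι (D.Z d)) =
      ∏ t ∈ Φ, sqClass (t x₀ - 2 * ι D.im) := by
  have him : (ι D.im) ^ 2 = -1 := by rw [← map_pow, D.im_sq, map_neg, map_one]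
  have hsplit := splitTwoTorsion_over him
  rw [hS1]
  have hterm : ∀ t ∈ Φ, galPtOver M t (.some x₀ y₀ h₀) =
      .some (t x₀) (t y₀) (nonsingular_apply_of_fixed (W := (curveA.baseChange M).toAffine) (t : M →+* M)
        (coeff_fixed_over t).1 (coeff_fixed_over t).2.1 (coeff_fixed_over t).2.2.1 (coeff_fixed_over t).2.2.2.1 (coeff_fixed_over t).2.2.2.2 h₀) :=
    fun t _ => galPtOver_some t h₀
  rw [Finset.sum_congr rfl hterm]
  refine twoDescentComponent_sum_apply hsplit Φ (fun t => (t : M →+* M)) (fun t => (coeff_fixed_over t).1) (fun t => (coeff_fixed_over t).2.1)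
    (fun t => (coeff_fixed_over t).2.2.1) (fun t => (coeff_fixed_over t).2.2.2.1) (fun t => (coeff_fixed_over t).2.2.2.2) h₀ ?_
  intro t ht
  have h2 : (2 : ℕ) • galPtOver M t (.some x₀ y₀ h₀) ≠ 0 := fun h0 => hS2 t ht (Or.inl h0)
  rw [hterm t ht] at h2
  exact (X_ne_of_two_smul_ne_zero him _ h2).1

/-- ★★★ **The same for the abscissa `e₁ = 0` (`τ(1) = (0, 0)`): `κ′_M(Z(d)) = [∏_{t∈Φ} x(z^t)]`.** [cite: TianYuanZhang2017, §3.1 (p0011 L53–L56)]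
[cite: SilvermanAEC2009, Prop. X.1.4] -/
theorem twoDescentComponent_genusPeriod_eq_prod_zero (D : GenusPointData n) {d : ℕ} (ι : D.H →ₐ[ℚ] M)
    {x₀ y₀ : M} (h₀ : (curveA.baseChange M).toAffine.Nonsingular x₀ y₀) (Φ : Finset (M ≃ₐ[ℚ] M))
    (hS1 : Point.map (W' := curveA) ι (D.Z d) = ∑ t ∈ Φ, galPtOver M t (.some x₀ y₀ h₀))
    (hS2 : ∀ t ∈ Φ, ¬ ((2 : ℕ) • galPtOver M t (.some x₀ y₀ h₀) = 0 ∨ (2 : ℕ) • galPtOver M t (.some x₀ y₀ h₀) = tauOne)) :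
    Point.twoDescentComponent (curveA.baseChange M).toAffine 0 (2 * ι D.im) (-(2 * ι D.im)) (Point.map (W' := curveA) ι (D.Z d)) =
      ∏ t ∈ Φ, sqClass (t x₀) := by
  have him : (ι D.im) ^ 2 = -1 := by rw [← map_pow, D.im_sq, map_neg, map_one]
  have hsplit := (splitTwoTorsion_over him).swap₁₂
  rw [hS1]
  have hterm : ∀ t ∈ Φ, galPtOver M t (.some x₀ y₀ h₀) =
      .some (t x₀) (t y₀) (nonsingular_apply_of_fixed (W := (curveA.baseChange M).toAffine) (t : M →+* M)
        (coeff_fixed_over t).1 (coeff_fixed_over t).2.1 (coeff_fixed_over t).2.2.1 (coeff_fixed_over t).2.2.2.1 (coeff_fixed_over t).2.2.2.2 h₀) :=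
    fun t _ => galPtOver_some t h₀
  rw [Finset.sum_congr rfl hterm]
  have key := twoDescentComponent_sum_apply hsplit Φ (fun t => (t : M →+* M)) (fun t => (coeff_fixed_over t).1)
    (fun t => (coeff_fixed_over t).2.1) (fun t => (coeff_fixed_over t).2.2.1) (fun t => (coeff_fixed_over t).2.2.2.1)
    (fun t => (coeff_fixed_over t).2.2.2.2) h₀ (fun t ht => by
      have h2 : (2 : ℕ) • galPtOver M t (.some x₀ y₀ h₀) ≠ 0 := fun h0 => hS2 t ht (Or.inl h0)
      rw [hterm t ht] at h2
      exact (X_ne_of_two_smul_ne_zero him _ h2).2.1)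
  simpa using key

/-! ## §3 The Φ-norm is fixed by every automorphism trivial on `L_d(i)` (display (S3)): it lies in the image of the genus field -/

/-- ★★ **`∏_{t∈Φ} (x(z^t) − e)` is fixed by every `g ∈ Aut_ℚ(M)` trivial on `ι(L_d(i))`**, for `e = 2i` — from (S3): `g` permutes the `z^t`.
[cite: TianYuanZhang2017, §3.1 (p0010 L89–L92, L111; p0011 L1–L8), proof of Lemma 3.21 (p0020 L55–L63)] -/
theorem norm_fixed_of_trivialOnL (D : GenusPointData n) {d : ℕ} (ι : D.H →ₐ[ℚ] M)
    {x₀ y₀ : M} (h₀ : (curveA.baseChange M).toAffine.Nonsingular x₀ y₀) (Φ : Finset (M ≃ₐ[ℚ] M))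
    (hS3 : ∀ g : M ≃ₐ[ℚ] M, D.TrivialOnLOver ι d g →
      ∃ π : Φ → Φ, Function.Bijective π ∧
        ∀ t : Φ, galPtOver M g (galPtOver M (t : M ≃ₐ[ℚ] M) (.some x₀ y₀ h₀)) = galPtOver M (π t : M ≃ₐ[ℚ] M) (.some x₀ y₀ h₀))
    (g : M ≃ₐ[ℚ] M) (hg : D.TrivialOnLOver ι d g) (e : M) (he : g e = e) :
    g (∏ t ∈ Φ, ((t : M ≃ₐ[ℚ] M) x₀ - e)) = ∏ t ∈ Φ, ((t : M ≃ₐ[ℚ] M) x₀ - e) := by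
  obtain ⟨π, hπ, hperm⟩ := hS3 g hg
  -- the action on abscissae: `g (t x₀) = (π t) x₀`
  have hx : ∀ t : Φ, g ((t : M ≃ₐ[ℚ] M) x₀) = ((π t : Φ) : M ≃ₐ[ℚ] M) x₀ := by
    intro t
    have e1 := hperm t
    rw [galPtOver_some (t : M ≃ₐ[ℚ] M) h₀, galPtOver_some g, galPtOver_some ((π t : Φ) : M ≃ₐ[ℚ] M) h₀] at e1
    exact (Point.some.injEq _ _ _ _ _ _).mp e1 |>.1
  rw [map_prod, ← Finset.prod_coe_sort Φ, ← Finset.prod_coe_sort Φ]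
  simp_rw [map_sub, he, hx]
  exact (Fintype.prod_bijective π hπ (fun t => (((π t : Φ) : M ≃ₐ[ℚ] M) x₀ - e)) (fun t => (((t : Φ) : M ≃ₐ[ℚ] M) x₀ - e))
    (fun _ => rfl)).symm ▸ rfl

end NormClass

end Summit.BirchSwinnertonDyer.PrintCf2.GenusPeriodNorm

namespace Summit.BirchSwinnertonDyer.PrintCf2.GenusPeriodNorm

open Literature.NumberTheory.EllipticCurves.TianYuanZhang2017.GenusPointData

/-! ## §4 Descent of the Φ-norm to `ℍ′_n`: an element of `M` fixed by `Gal(M/ι ℍ′_n)` comes from `ℍ′_n` (Galois correspondence) -/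

section Descent

variable {n : ℕ} {M : Type} [Field M] [NumberField M] [IsGalois ℚ M]

/-- Square classes are multiplicative over a `Finset` of non-zero elements. [folklore] -/
theorem sqClass_prod_of_ne_zero {F : Type*} [Field F] {κ : Type*} (s : Finset κ) (f : κ → F)
    (hf : ∀ i ∈ s, f i ≠ 0) : sqClass (∏ i ∈ s, f i) = ∏ i ∈ s, sqClass (f i) := by
  classical
  induction s using Finset.induction_on with
  | empty =>
    rw [Finset.prod_empty, Finset.prod_empty]
    have h1 := sqClass_sq (1 : F)
    rwa [one_pow] at h1
  | insert a s ha ih =>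
    have hs : ∀ i ∈ s, f i ≠ 0 := fun i hi => hf i (Finset.mem_insert_of_mem hi)
    rw [Finset.prod_insert ha, Finset.prod_insert ha,
      sqClass_mul (hf a (Finset.mem_insert_self a s)) (Finset.prod_ne_zero_iff.mpr hs), ih hs]

omit [IsGalois ℚ M] in
/-- An automorphism of `M` fixing `ι(ℍ′_n)` pointwise is trivial on `ι(L_d(i))` for every `d`. [cite: TianYuanZhang2017, §3.1 (p0011 L60–L64: L_n(i) ⊂ ℍ′_n)] -/
theorem trivialOnLOver_of_mem_fixingSubgroup (D : GenusPointData n) (ι : D.H →ₐ[ℚ] M) (d : ℕ) {g : M ≃ₐ[ℚ] M}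
    (hg : g ∈ IntermediateField.fixingSubgroup ι.fieldRange) : D.TrivialOnLOver ι d g := by
  rw [IntermediateField.mem_fixingSubgroup_iff] at hg
  exact ⟨hg _ (ι.mem_fieldRange.mpr ⟨_, rfl⟩), fun d' _ _ => hg _ (ι.mem_fieldRange.mpr ⟨_, rfl⟩)⟩

/-- **Galois descent**: an element of `M` fixed by every automorphism fixing `ι(ℍ′_n)` pointwise lies in `ι(ℍ′_n)` (`M/ℚ` Galois).
[cite: Lang2002, VI §1 Thm. 1.2, Cor. 1.4] -/
theorem exists_eq_of_forall_fixing (D : GenusPointData n) (ι : D.H →ₐ[ℚ] M) {N : M}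
    (hN : ∀ g : M ≃ₐ[ℚ] M, g ∈ IntermediateField.fixingSubgroup ι.fieldRange → g N = N) : ∃ N₀ : D.H, ι N₀ = N := by
  have hmem : N ∈ IntermediateField.fixedField (IntermediateField.fixingSubgroup ι.fieldRange) :=
    (IntermediateField.mem_fixedField_iff _ _).mpr fun g hg => hN g hg
  rw [IsGalois.fixedField_fixingSubgroup] at hmem
  exact ι.mem_fieldRange.mp hmem

/-- ★★★ **THE `2`-DESCENT CLASS OF THE GENUS PERIOD OF A SEVEN-BLOCK, READ IN `M`, IS THE CLASS OF AN ELEMENT OF `ℍ′_n` WHICH IS THE Φ-NORM OF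
`x(z) − 2i`.**  For the data (S1)–(S3) of the seven-block display at `d` (`ι(Z(d)) = Σ_{t∈Φ} z^t`, `z = (x₀, y₀)`, no `z^t` a cusp, automorphisms
trivial on `ι(L_d(i))` permute the `z^t`): there is `N₀ ∈ ℍ′_n` with `ι(N₀) = ∏_{t∈Φ} (t x₀ − 2ι(i))` and
`κ_M(ι Z(d)) = [ι N₀]` (the `2`-descent component at `T⁺ = (2i, 0)`).  In the source's terms (block-free `n = d = lq`): `N₀ = N_{H_n(i)/L_n(i)}(x(z_n) − 2i)`,
a norm of a CM value of the level-32 modular unit `x − 2i`.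
[cite: TianYuanZhang2017, §3.1 (p0010 L89–L92, L111; p0011 L1–L8, L53–L66)] [cite: SilvermanAEC2009, Prop. X.1.4] [cite: Lang2002, VI §1 Thm. 1.2] -/
theorem exists_norm_in_H_twoDescentComponent_genusPeriod_eq (D : GenusPointData n) {d : ℕ} (ι : D.H →ₐ[ℚ] M)
    {x₀ y₀ : M} (h₀ : (curveA.baseChange M).toAffine.Nonsingular x₀ y₀) (Φ : Finset (M ≃ₐ[ℚ] M))
    (hS1 : Point.map (W' := curveA) ι (D.Z d) = ∑ t ∈ Φ, galPtOver M t (.some x₀ y₀ h₀))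
    (hS2 : ∀ t ∈ Φ, ¬ ((2 : ℕ) • galPtOver M t (.some x₀ y₀ h₀) = 0 ∨ (2 : ℕ) • galPtOver M t (.some x₀ y₀ h₀) = tauOne))
    (hS3 : ∀ g : M ≃ₐ[ℚ] M, D.TrivialOnLOver ι d g →
      ∃ π : Φ → Φ, Function.Bijective π ∧
        ∀ t : Φ, galPtOver M g (galPtOver M (t : M ≃ₐ[ℚ] M) (.some x₀ y₀ h₀)) = galPtOver M (π t : M ≃ₐ[ℚ] M) (.some x₀ y₀ h₀)) :
    ∃ N₀ : D.H, ι N₀ = ∏ t ∈ Φ, ((t : M ≃ₐ[ℚ] M) x₀ - 2 * ι D.im) ∧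
      Point.twoDescentComponent (curveA.baseChange M).toAffine (2 * ι D.im) 0 (-(2 * ι D.im)) (Point.map (W' := curveA) ι (D.Z d)) =
        sqClass (ι N₀) := by
  have hfix : ∀ g : M ≃ₐ[ℚ] M, g ∈ IntermediateField.fixingSubgroup ι.fieldRange →
      g (∏ t ∈ Φ, ((t : M ≃ₐ[ℚ] M) x₀ - 2 * ι D.im)) = ∏ t ∈ Φ, ((t : M ≃ₐ[ℚ] M) x₀ - 2 * ι D.im) := by
    intro g hg
    have hgL := trivialOnLOver_of_mem_fixingSubgroup D ι d hg
    refine norm_fixed_of_trivialOnL D ι h₀ Φ hS3 g hgL (2 * ι D.im) ?_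
    rw [map_mul, hgL.1, map_ofNat]
  obtain ⟨N₀, hN₀⟩ := exists_eq_of_forall_fixing D ι hfix
  refine ⟨N₀, hN₀, ?_⟩
  rw [twoDescentComponent_genusPeriod_eq_prod_two_im D ι h₀ Φ hS1 hS2, hN₀]
  -- `∏ sqClass = sqClass ∏` (no factor vanishes)
  have hne : ∀ t ∈ Φ, (t : M ≃ₐ[ℚ] M) x₀ - 2 * ι D.im ≠ 0 := by
    intro t ht
    have him : (ι D.im) ^ 2 = -1 := by rw [← map_pow, D.im_sq, map_neg, map_one]
    have h2 : (2 : ℕ) • galPtOver M t (.some x₀ y₀ h₀) ≠ 0 := fun h0 => hS2 t ht (Or.inl h0)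
    rw [galPtOver_some t h₀] at h2
    exact sub_ne_zero.mpr (X_ne_of_two_smul_ne_zero him _ h2).1
  exact (sqClass_prod_of_ne_zero Φ _ hne).symm

end Descent

end Summit.BirchSwinnertonDyer.PrintCf2.GenusPeriodNorm

namespace Summit.BirchSwinnertonDyer.PrintCf2.GenusPeriodNorm

open Literature.NumberTheory.EllipticCurves.TianYuanZhang2017.GenusPointData NumberField

/-! ## §5 By name from the one display fact: on every seven-block (in particular `n = lq` itself) the genus period's class is a norm class from `ℍ′_n` -/

section ByName

variable {n : ℕ}

/-- `g(d) = #2Cl(ℚ(√−d)) ≥ 1` (the trivial class is a square; the class group is finite). [cite: TianYuanZhang2017, §1 (p0002 L78–L82)] -/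
theorem gK_pos (d : ℕ) : 0 < gK d := by
  unfold gK genusClassNumber
  exact Nat.card_pos_iff.mpr ⟨⟨⟨1, IsSquare.one⟩⟩, inferInstance⟩

/-- ★★★ **THE GENUS PERIOD OF A SEVEN-BLOCK IS A NORM CLASS, BY NAME.**  Granted the display fact `tyz_sevenBlockCMData`: for every square-free
`n ≡ 5, 6, 7 (mod 8)` there is a display package `D` of `n` (`Printed`, CM-point layer, Thm 3.5 at blocks, seven-block layer) such that for every block
`d ∣ n`, `d ≡ 7 (mod 8)`: there are a Galois number field `M ⊇ ℍ′_n` (embedding `ι`), an affine point `z = (x₀, y₀) ∈ A(M)` (the CM point `z_d`), a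
finite set `Φ ⊂ Aut_ℚ(M)` of cardinality `g(d)` (lifts of `2Cl_d`) with `ι(Z(d)) = Σ_{t∈Φ} z^t`, and an element **`N₀ ∈ ℍ′_n` with
`ι(N₀) = ∏_{t∈Φ} (t x₀ − 2i)` and `κ_M(ι Z(d)) = [ι N₀]`** (the `2`-descent component at `T⁺ = (2i, 0)`).  For block-free `n = lq` and `d = n`:
`N₀ = N_{H_n(i)/L_n(i)}(x(z_n) − 2i)` — the `2`-descent class of the genus period is the class of the NORM of the CM value of the level-32 modular unit
`x − 2i`, read in `M`.  [cite: TianYuanZhang2017, §3.1 (p0010 L89–L92, L111; p0011 L1–L8, L53–L66), §3.2 (p0012 L8–L9)] [cite: SilvermanAEC2009, Prop. X.1.4]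
[cite: Lang2002, VI §1 Thm. 1.2] -/
theorem exists_normClass_genusPeriod_of_facts (hT : tyz_sevenBlockCMData) (hsq : Squarefree n) (h8 : n % 8 = 5 ∨ n % 8 = 6 ∨ n % 8 = 7) :
    ∃ D : GenusPointData n, D.Printed ∧ D.CMPointCompositumPrinted ∧ D.Thm35AtBlocks ∧
      ∀ d ∈ n.divisors, d % 8 = 7 →
        ∃ (M : Type) (_ : Field M) (_ : NumberField M) (_ : IsGalois ℚ M) (ι : D.H →ₐ[ℚ] M) (x₀ y₀ : M)
          (h₀ : (curveA.baseChange M).toAffine.Nonsingular x₀ y₀) (Φ : Finset (M ≃ₐ[ℚ] M)) (N₀ : D.H),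
          Φ.card = gK d ∧
          Point.map (W' := curveA) ι (D.Z d) = ∑ t ∈ Φ, galPtOver M t (.some x₀ y₀ h₀) ∧
          ι N₀ = ∏ t ∈ Φ, ((t : M ≃ₐ[ℚ] M) x₀ - 2 * ι D.im) ∧
          Point.twoDescentComponent (curveA.baseChange M).toAffine (2 * ι D.im) 0 (-(2 * ι D.im)) (Point.map (W' := curveA) ι (D.Z d)) =
            sqClass (ι N₀) := by
  obtain ⟨D, hPr, hC, hBl, hS⟩ := hT n hsq h8
  refine ⟨D, hPr, hC, hBl, fun d hd hd7 => ?_⟩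
  obtain ⟨M, iF, iN, iG, ι, z, Φ, ⟨hS1, hcard⟩, hS2, hS3⟩ := hS d hd hd7
  -- `Φ` is non-empty (`#Φ = g(d) ≥ 1`), so `z ≠ 0` by (S2): `z = (x₀, y₀)`
  have hΦ : Φ.Nonempty := Finset.card_pos.mp (by rw [hcard]; exact gK_pos d)
  obtain ⟨t₀, ht₀⟩ := hΦ
  have hz : z ≠ 0 := by
    intro hz
    apply galPtOver_ne_zero_of_not_cusp hS2 ht₀
    rw [hz, _root_.map_zero]
  rcases z with _ | ⟨x₀, y₀, h₀⟩
  · exact absurd rfl hz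
  obtain ⟨N₀, hN₀, hκ⟩ := exists_norm_in_H_twoDescentComponent_genusPeriod_eq D ι h₀ Φ hS1 hS2 hS3
  exact ⟨M, iF, iN, iG, ι, x₀, y₀, h₀, Φ, N₀, hcard, hS1, hN₀, hκ⟩

/-- ★★★ **R2 specialisation** (`n = lq`, `l ≡ 1`, `q ≡ 7 (mod 8)`; `n` is its own seven-block): granted `tyz_sevenBlockCMData`, there is a display
package `D` of `lq` — the same kind of package in which `…GenusPeriodR2.levelTwo_iff_genusPeriod_R2` reads C⁺ as «depth `Z(lq)` = [`X(h) ∈ 2ℚ^{×2}`]» —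
together with `M ⊇ ℍ′_{lq}`, the CM point `z = (x₀, y₀)`, `Φ` (`#Φ = g(lq)`) and `N₀ ∈ ℍ′_{lq}` with `ι(Z(lq)) = Σ_{t∈Φ} z^t`, `ι(N₀) = ∏_{t∈Φ}(t x₀ − 2i)`,
`κ_M(ι Z(lq)) = [ι N₀]`. [cite: TianYuanZhang2017, §3.1, §3.2] [cite: SilvermanAEC2009, Prop. X.1.4] -/
theorem exists_normClass_genusPeriod_R2 (hT : tyz_sevenBlockCMData) {l q : ℕ} (hl : l.Prime) (hq : q.Prime) (hl8 : l % 8 = 1)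
    (hq8 : q % 8 = 7) (hn : n = l * q) :
    ∃ D : GenusPointData n, D.Printed ∧ D.CMPointCompositumPrinted ∧ D.Thm35AtBlocks ∧
      ∃ (M : Type) (_ : Field M) (_ : NumberField M) (_ : IsGalois ℚ M) (ι : D.H →ₐ[ℚ] M) (x₀ y₀ : M)
        (h₀ : (curveA.baseChange M).toAffine.Nonsingular x₀ y₀) (Φ : Finset (M ≃ₐ[ℚ] M)) (N₀ : D.H),
        Φ.card = gK n ∧
        Point.map (W' := curveA) ι (D.Z n) = ∑ t ∈ Φ, galPtOver M t (.some x₀ y₀ h₀) ∧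
        ι N₀ = ∏ t ∈ Φ, ((t : M ≃ₐ[ℚ] M) x₀ - 2 * ι D.im) ∧
        Point.twoDescentComponent (curveA.baseChange M).toAffine (2 * ι D.im) 0 (-(2 * ι D.im)) (Point.map (W' := curveA) ι (D.Z n)) =
          sqClass (ι N₀) := by
  have hmod : n % 8 = 7 := by rw [hn, Nat.mul_mod, hl8, hq8]
  have hsq : Squarefree n := by
    subst hn
    have hne : l ≠ q := fun h => by subst h; omega
    exact Nat.squarefree_mul_iff.mpr ⟨(Nat.coprime_primes hl hq).mpr hne, hl.squarefree, hq.squarefree⟩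
  obtain ⟨D, hPr, hC, hBl, hall⟩ := exists_normClass_genusPeriod_of_facts hT hsq (Or.inr (Or.inr hmod))
  exact ⟨D, hPr, hC, hBl, hall n (Nat.mem_divisors_self n hsq.ne_zero) hmod⟩

end ByName

end Summit.BirchSwinnertonDyer.PrintCf2.GenusPeriodNorm

end
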